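import Summits.BirchSwinnertonDyer.BirchSwinnertonDyer.Theses.ByReductionTypeAtTwo
import Summits.BirchSwinnertonDyer.BirchSwinnertonDyer.Theorems.ByReductionTypeAtTwoSupersingularUniformFlatLine
import Summits.BirchSwinnertonDyer.BirchSwinnertonDyer.Theorems.ByReductionTypeAtTwoSupersingularUniformFlatLineFineMu
import Summits.BirchSwinnertonDyer.BirchSwinnertonDyer.Theorems.ByReductionTypeAtTwoSupersingularFlatBlindEulerChar
import Summits.BirchSwinnertonDyer.BirchSwinnertonDyer.Theorems.ByReductionTypeAtTwoSupersingularFlatBlindNoCotorsion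
import Summits.BirchSwinnertonDyer.BirchSwinnertonDyer.Theorems.ByReductionTypeAtTwoSupersingularFlatBlindLocalTransversalityApZero
import Summits.BirchSwinnertonDyer.BirchSwinnertonDyer.Theorems.ByReductionTypeAtTwoSupersingularFlatBlindHondaRung
import Summits.BirchSwinnertonDyer.BirchSwinnertonDyer.Theorems.ByReductionTypeAtTwoSupersingularFlatBlindControlOfLocal
import Summits.BirchSwinnertonDyer.BirchSwinnertonDyer.Theorems.ByReductionTypeAtTwoSupersingularFlatBlindCardHondaHolds
import Summits.BirchSwinnertonDyer.BirchSwinnertonDyer.Theorems.ByReductionTypeAtTwoSupersingularFlatNoFiniteSubmoduleHondaOfClassical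
import Summits.BirchSwinnertonDyer.BirchSwinnertonDyer.Theorems.ByReductionTypeAtTwoSupersingularClassicalNoFiniteSubmoduleAtTwo
import Summits.BirchSwinnertonDyer.BirchSwinnertonDyer.Theorems.ByReductionTypeAtTwoSupersingularSelmerCorankCyclotomicLayersBounded
import Literature.NumberTheory.EllipticCurves.KatoTwistedSelmerFinitenessLayers
import Summits.BirchSwinnertonDyer.BirchSwinnertonDyer.Theorems.ByReductionTypeAtTwoSupersingularFlatLocalDataOfHondaSystem
import Literature.NumberTheory.EllipticCurves.Kato2004.EulerSystemBoundFineSelmerTwo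
import Literature.NumberTheory.EllipticCurves.Kato2004.MainConjecturePrimeTDoorProofs
import Summits.BirchSwinnertonDyer.BirchSwinnertonDyer.Theorems.ByReductionTypeAtTwoSupersingularRankZeroAtTwoStubHondaAtTwo
import Summits.BirchSwinnertonDyer.BirchSwinnertonDyer.Theorems.ByReductionTypeAtTwoSupersingularFlatRoadCountTwo
import Summits.BirchSwinnertonDyer.BirchSwinnertonDyer.Theorems.ByReductionTypeAtTwoSupersingularFlatBlindPinchBSDp
import Summits.BirchSwinnertonDyer.BirchSwinnertonDyer.Theorems.ByReductionTypeAtTwoSupersingularBlindPinchBlindZeroOfTwistSelmerCorank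
import Literature.NumberTheory.EllipticCurves.TateModuleFreeProofs
import Summits.BirchSwinnertonDyer.BirchSwinnertonDyer.Theorems.ByReductionTypeAtTwoSupersingularH1IwPointsModelFreeOfGreenberg1989
import Summits.BirchSwinnertonDyer.BirchSwinnertonDyer.Theorems.ByReductionTypeAtTwoSupersingularFlatKernelCyclicHondaOfH1IwFree
import Literature.NumberTheory.EllipticCurves.CoatesGreenberg1996.GoodModelKernelH1OfDeeplyRamifiedProofs
import Summits.BirchSwinnertonDyer.Rank1Residual.F1Sign2.HondaSystemAtTwo
import Summits.BirchSwinnertonDyer.Rank1Residual.Supersingular.BlindControlTwo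
import Summits.BirchSwinnertonDyer.Rank1Residual.Supersingular.BlindPointDerivAt
import Summits.BirchSwinnertonDyer.Rank1Residual.P2.EmptyCellsAtTwo
import Literature.NumberTheory.EllipticCurves.PadicFormalLogOrder
import Literature.NumberTheory.EllipticCurves.QuadraticTwist
import Literature.NumberTheory.EllipticCurves.Rank1Residual.Predicates
import Literature.NumberTheory.EllipticCurves.AnalyticRankOrderProofs
import Literature.NumberTheory.EllipticCurves.Rank1Residual.MuLambdaCarriers
import Literature.NumberTheory.EllipticCurves.Kato2004.DivisibilityInputsZetaLine
import HarnessLib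
import Summits.BirchSwinnertonDyer.BirchSwinnertonDyer.Theorems.ByReductionTypeAtTwoSupersingularFlatBlindPinchOfAvatar
-- W-90 (imc g36): v2.18 OPTION cert = LEAD ss-1 GEN 25 PinchBranch.lean @0e1f3fa1566c5fcf with the pinch certificate re-keyed to the L-VALUE BIT (D-imc-90)


set_option autoImplicit false
set_option linter.dupNamespace false
set_option linter.unusedVariables false

noncomputable section

open scoped Classical MatrixGroups ModularForm NumberField
open NumberField IsDedekindDomain CongruenceSubgroup WeierstrassCurve PowerSeries
open Literature.NumberTheory.EllipticCurves Literature.NumberTheory.EllipticCurves.IwasawaDual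
  Literature.NumberTheory.EllipticCurves.Sprung2012 Literature.NumberTheory.EllipticCurves.Sprung2017
  Literature.NumberTheory.EllipticCurves.ModularForms
  Literature.NumberTheory.EllipticCurves.Rank1Residual Literature.NumberTheory.EllipticCurves.Rank1Residual.Typed
  Literature.NumberTheory.EllipticCurves.Kobayashi2003 Literature.NumberTheory.GaloisRepresentations ZpExtension
open Summit.BirchSwinnertonDyer.Rank1Residual Summit.BirchSwinnertonDyer.Rank1Residual.Supersingular
  Summit.BirchSwinnertonDyer.Rank1Residual.Supersingular.BlindLever Summit.BirchSwinnertonDyer.Rank1Residual.X5.O1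

open Literature.NumberTheory.EllipticCurves.AcSigned Summit.BirchSwinnertonDyer.Rank1Residual.X1.MuLambda
  Summit.BirchSwinnertonDyer.BirchSwinnertonDyer.Theorems

namespace ScratchV218W90

/-- Statement of `stub_pub`: the PUBLISHED inputs, by the tree's fact names — modularity (Wiles–BCDT), GZK
(`rank = r_an ∧ Ш finite` for `r_an ≤ 1`), Kato's two accepted facts (Astérisque 295 Thm. 12.4), entire continuation of
`L(E,s)` over `ℚ` (v2.12 = the v2.10.1 body again: the v2.11 conjunct hPT — Poitou–Tate duality for finite Selmer structures over `ℚ`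
with the real places — is the TREE THEOREM `OddBlindLocal.poitouTateReal_rat` (p822193 ← p626891) and is no longer carried); v2.14 (director
(830)(iii)): PLUS the two print inputs of slot 4a — the Cassels–Tate pairing on the layers `Sel_{p^∞}(E/K_n)` of a `ℤ_p`-tower (alternating,
kernel the divisible elements, Galois-equivariant, restriction adjoint to corestriction; Cassels 1962 / Milne ADT I.6.13 / Hachimori–Matsuno
2000 p. 2540) and Kato's Cor. 14.3 (1) in the layer form (`L(E,χ,1) ≠ 0 ⟹ Sel(E/ℚ_n)^{(χ)}` finite, every `p` including `2`, Astérisque 295 p. 235).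
[cite: BCDTJAMS2001, Theorem A] [cite: Kato2004Asterisque, Thm. 12.4] [cite: Kolyvagin1990, Thm. A] [cite: HachimoriMatsuno2000, Theorem (p. 2540)]
[cite: Kato2004Asterisque, Thm. 14.2 (2) and Cor. 14.3 (1) (p. 235)] v2.16 (director (844)): PLUS Kato's Thm. 13.4 (2) AT `p = 2` — the Euler-system bound
`ℓ_𝔭(X₀(E/ℚ_∞)) ≤ ℓ_𝔭(𝐇¹_Γ(T₂E)/Λs)` at the height-one primes `𝔭 ∌ 2` for a non-zero genuine `2`-adic Euler-system class `s` (the set of primes at which Kato states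
Conj. 12.10 for `p = 2`), the F4rat conjunct of the old ♭ package, now by fact name; AND (folding v2.15) Greenberg 1989 §3 Cor. 2 (for a `ℤ_p`-extension
`K_∞/K` of a `p`-adic field and `A = E[p^∞]` with `A(K_∞) = 0`, the Pontryagin dual of `H¹(K_∞, A)` is `Λ`-free of rank `2[K:ℚ_p]`), the one print input of K86
(`H¹_Iw(ℚ₂, T₂E)` free of rank `2` in the points model; Coates–Greenberg 1996 Cor. 3.2 is the tree THEOREM `CoatesGreenberg1996.H1_goodModelKernel_trivial_holds`).
[cite: Kato2004Asterisque, Thm. 13.4 (2) (p. 226), Conj. 12.10 (p. 224)] [cite: Greenberg1989, §3 Corollary 2 (Adv. Stud. Pure Math. 17, p. 112)] -/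
def PublishedInputsAtTwo : Prop :=
  (nonempty_modularParametrizationData ∧ rank_eq_analyticRank_of_analyticRank_le_one) ∧
    (Kato2004.thm12_4 ∧ Kato2004_fineSelmerDual_isTorsion) ∧
    (hasEntireLFunction_rat ∧ (HachimoriMatsuno2000.casselsTate_layerPairing.{0} ∧
      (Literature.NumberTheory.EllipticCurves.kato_finite_chiPart_selmerLayer_of_twistedLValue_ne_zero ∧
        (Literature.NumberTheory.EllipticCurves.Kato2004.thm13_4_two_lengthAt_fineSelmerDual_le_of_isEulerSystemClassTwo ∧
          Literature.NumberTheory.EllipticCurves.Greenberg1989.localH1Dual_free_of_towerTorsion_trivial))))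

/-- Statement of `stub_allFlatData` (v2.7) — `UniformFlatDataAtTwo` (the line of record `flat_uniform_two.lean` stub (2), kept
VERBATIM above) WITH THE HONDA LEGALITY CLAUSE EXPORTED: after (SAT), `∃ cneg, F1Sign2.IsHondaSystemAtTwo κ ι W (W.frobeniusTrace 2) g cneg c`
— the produced `c` is the `c`-part of a Honda system at two (computed bottom relations `c 0 = (a²−2a−1)·c₋`, `Tr_{1/0} c 1 = a·c 0 + (4−2a)·c₋`,
Sprung's two-generation clauses in dual form at every layer).  Zero content cost (LEAD ss-1 GEN 19 (L1b), pen RC-705): the intended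
witness IS Sprung's Honda system (`F1Sign2.HondaSystemAtTwoExists` = (C1), [Sprung2012] Thm. 2.2 / Lemma 7.9 at `p = 2`), whose Coleman
maps carry COUNT♭ / CK♭; `uniformFlatDataAtTwo_of_honda` recovers the guard-free v2.6 statement for the T-84 consumer.  v2.12 (δ): the guarded
`(2)`-conjunct is DROPPED here too (same edit as in `UniformFlatDataAtTwo`).  BEYOND PRINT AT 2 as before.  [cite: Sprung2012, Thm. 2.2, Lemma 7.9, 7.14, 7.16] [cite: Sprung2024, Lemmas 5.5–5.9] [cite: Kato2004Asterisque, Thm. 12.5] -/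
def UniformFlatHondaDataAtTwo : Prop :=
      ∀ (W : WeierstrassCurve ℚ) [W.IsElliptic] [W.IsGloballyMinimal],
      ¬ W.HasCM → W.analyticRank = 0 → GoodSS W 2 →
      ∀ (κ : ZpExtension ℚ 2) (γ : Field.absoluteGaloisGroup ℚ),
        κ.IsCyclotomic → κ.IsTopGenerator γ → IsCyclotomicVariable 2 γ →
      ∀ (v : HeightOneSpectrum (𝓞 ℚ)), (2 : 𝓞 ℚ) ∈ v.asIdeal →
      ∃ (g : Field.absoluteGaloisGroup (v.adicCompletion ℚ)) (c : ℕ → localPoints W (v.adicCompletion ℚ)),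
        κ.IsTopGenerator (resGalOfEmb (closureEmb (K := ℚ) (v.adicCompletion ℚ)) g) ∧
        (∀ n, c n ∈ localLayerPointsOfEmb κ (closureEmb (K := ℚ) (v.adicCompletion ℚ)) W n) ∧
        (∀ n, 1 ≤ n → localTraceOfEmb κ (closureEmb (K := ℚ) (v.adicCompletion ℚ)) W n (n + 1)
          (c (n + 1)) = W.frobeniusTrace 2 • c n - c (n - 1)) ∧
        (∀ z₀ : localLayerPointsOfEmb κ (closureEmb (K := ℚ) (v.adicCompletion ℚ)) W 0 →+ ℤ_[2],
          evalOn W (localLayerPointsOfEmb κ (closureEmb (K := ℚ) (v.adicCompletion ℚ)) W 0) z₀ (c 0) = 0 →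
            z₀ = 0) ∧
        (∀ a : ℤ_[2],
          (∃ z₀ : localLayerPointsOfEmb κ (closureEmb (K := ℚ) (v.adicCompletion ℚ)) W 0 →+ ℤ_[2],
            evalOn W (localLayerPointsOfEmb κ (closureEmb (K := ℚ) (v.adicCompletion ℚ)) W 0) z₀ (c 0) =
              2 * a) →
          ∃ y : localLayerPointsOfEmb κ (closureEmb (K := ℚ) (v.adicCompletion ℚ)) W 0 →+ ℤ_[2],
            evalOn W (localLayerPointsOfEmb κ (closureEmb (K := ℚ) (v.adicCompletion ℚ)) W 0) y (c 0) = a) ∧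
        (∃ cneg : localPoints W (v.adicCompletion ℚ),
          Summit.BirchSwinnertonDyer.Rank1Residual.F1Sign2.IsHondaSystemAtTwo κ
            (closureEmb (K := ℚ) (v.adicCompletion ℚ)) W (W.frobeniusTrace 2) g cneg c) ∧
        (Finite (W.selmerGroupPInfty 2) →
          Finite (EndCoinvariants (conjSharpFlatSelmerInfty W κ (closureEmb (K := ℚ) (v.adicCompletion ℚ))
            (W.frobeniusTrace 2) g c .flat γ - 1)) →
          Nat.card (↥((sharpFlatSelmerInfty W κ (closureEmb (K := ℚ) (v.adicCompletion ℚ))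
                (W.frobeniusTrace 2) g c .flat).comap (W.layerToInfty κ 0)) ⧸
              (W.selmerLayer κ 0).addSubgroupOf
                ((sharpFlatSelmerInfty W κ (closureEmb (K := ℚ) (v.adicCompletion ℚ))
                  (W.frobeniusTrace 2) g c .flat).comap (W.layerToInfty κ 0))) *
            Nat.card (MulAction.fixedPoints (Field.absoluteGaloisGroup ℚ) (W.geomPrimaryTorsion 2)) =
          2 ^ (padicValNat 2 W.tamagawaProduct) *
            Nat.card (EndCoinvariants (conjSharpFlatSelmerInfty W κ
              (closureEmb (K := ℚ) (v.adicCompletion ℚ)) (W.frobeniusTrace 2) g c .flat γ - 1))) ∧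
        (∀ [NeZero (W.conductorNorm ℤ)] (f : CuspForm (Gamma0 (W.conductorNorm ℤ)) 2),
            IsNewformOf W f → ∀ (ϖ : ℚ), (ϖ : ℝ) * W.realPeriodRat = plusPeriod f →
          ∀ (Ls Lf : IwasawaAlgebra 2), IsSprungPair f 2 (W.frobeniusTrace 2) Ls Lf →
          ∀ (D : SharpFlatSelmerDualData W κ γ (closureEmb (K := ℚ) (v.adicCompletion ℚ))
              (W.frobeniusTrace 2) g c .flat) [ContinuousSMul ℤ_[2] (W.tateModule 2)],
            ∃ (I : Kato2004.IwasawaH1Data W 2 κ γ) (Y : W.FineSelmerDualData κ γ)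
              (P : Submodule (IwasawaAlgebra 2) (IwasawaAlgebra 2))
              (loc : I.H →ₗ[IwasawaAlgebra 2] P) (toX : P →ₗ[IwasawaAlgebra 2] D.X)
              (δ : D.X →ₗ[IwasawaAlgebra 2] Y.X) (Z : Submodule (IwasawaAlgebra 2) I.H)
              (G : IwasawaAlgebra 2),
              Function.Exact loc toX ∧ Function.Exact toX δ ∧
              G ∈ Submodule.map (P.subtype ∘ₗ loc) Z ∧
              iwasawaToPowerSeries 2 G = PowerSeries.C (ϖ : ℚ_[2]) * iwasawaToPowerSeries 2 Lf ∧
              (∀ 𝔭 : PrimeSpectrum (IwasawaAlgebra 2), 𝔭.asIdeal.height = 1 →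
                PowerSeries.C (2 : ℤ_[2]) ∉ 𝔭.asIdeal →
                Literature.NumberTheory.EllipticCurves.Module.lengthAt (IwasawaAlgebra 2) Y.X 𝔭 ≤
                  Literature.NumberTheory.EllipticCurves.Module.lengthAt (IwasawaAlgebra 2) (I.H ⧸ Z) 𝔭))

/-- Statement of `stub_fineMu` (v2.12, T-84 / D-imc-84) — Coates–Sujatha statement (A) at `(E,2)` on every curve of the habitat:
`μ(X₀(E/ℚ_∞)) = 0` for the `2`-primary FINE Selmer dual (`Rank1Residual.FineMuZeroAt W 2`: every pinned `FineSelmerDualData` that is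
Λ-f.g. and torsion has `muInvariant 2 _ = 0`).  CONJECTURE class-wide; COROLLARY-OF-PRINT per certified row (odd class number of the cubic /
sextic field inside `ℚ(E[4])`: `Lim2017.thm35_at_two_fineSelmerDual_moduleFinite_of_classicalMuVanishes_of_le_divisionField_four` + Iwasawa 1956).
REPLACES v2.11's `MuFlatOfNonSurjAtTwo` (μ♭ = 0 on the non-surjective classes). [cite: CoatesSujatha2005, §3 statement (A)]
[cite: Lim2017, Thm. 3.5] [cite: Wuthrich2006MRL, Lemma 1 and Thm. 2 (p. 715; odd p shape)] -/
def FineMuZeroOnHabitatAtTwo : Prop :=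
      ∀ (W : WeierstrassCurve ℚ) [W.IsElliptic] [W.IsGloballyMinimal],
      ¬ W.HasCM → W.analyticRank = 0 → GoodSS W 2 →
        Literature.NumberTheory.EllipticCurves.Rank1Residual.FineMuZeroAt W 2


/-- Statement of `stub_lowerOffGenericOdd` (v2.18 OPTION W-90, -imc g36): Miller's LOWER half off the generic odd locus AND off the
L-VALUE-BIT PINCH locus «v₂(L(E,1)/Ω_E) ≤ 1 ∧ corank Sel_{2^∞}(E^{(2)}) ≥ 2» — NO newform / period / Sprung-pair / avatar binders. -/
def LowerBoundOffGenericOddAtTwo : Prop :=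
  ∀ (W : WeierstrassCurve ℚ) [W.IsElliptic] [W.IsGloballyMinimal],
    ¬ W.HasCM → W.analyticRank = 0 → GoodSS W 2 →
    (W.rootNumber * ZMod.χ₈ (W.conductorNorm ℤ : ZMod 8) = -1 →
      ∀ (W₂ : WeierstrassCurve ℚ) [W₂.IsElliptic] [W₂.IsGloballyMinimal],
        (∃ C : WeierstrassCurve.VariableChange ℚ, C • W.quadraticTwist 2 = W₂) → W₂.analyticRank ≠ 1) →
    (∀ (t : ℚ), W.entireLFunction 1 / (W.realPeriodRat : ℂ) = ((t : ℚ) : ℂ) → padicValRat 2 t ≤ 1 →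
      ∀ (W₂ : WeierstrassCurve ℚ) [W₂.IsElliptic],
        (∃ C : WeierstrassCurve.VariableChange ℚ, C • W.quadraticTwist 2 = W₂) → W₂.selmerCorank 2 ≤ 1) →
    MissingLowerBoundAt W 2

/-! ### §A — verbatim copy of `Cruxes/SupersingularRankZeroAtTwo/D90LValueBitPinchAtTwo.lean` (cabb9f15436c0005), nested as `D90` until it is a Theorems module -/

namespace D90

/-! ## K90-V / K90-U — two `ℤ_p` facts -/

/-- **K90-V.** `pⁿ ∣ x` in `ℤ_p` and `(x : ℚ_p) = q` with `q ∈ ℚˣ` ⟹ `n ≤ v_p(q)`. [folklore] -/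
theorem le_padicValRat_of_pow_dvd {p : ℕ} [Fact p.Prime] {x : ℤ_[p]} {q : ℚ} (hq : q ≠ 0)
    (hx : (x : ℚ_[p]) = ((q : ℚ) : ℚ_[p])) {n : ℕ} (hn : (p : ℤ_[p]) ^ n ∣ x) : (n : ℤ) ≤ padicValRat p q := by
  have h1 : ‖x‖ ≤ (p : ℝ) ^ (-n : ℤ) :=
    (PadicInt.norm_le_pow_iff_mem_span_pow x n).mpr (Ideal.mem_span_singleton.mpr hn)
  rw [PadicInt.norm_def, hx, Padic.eq_padicNorm, padicNorm.eq_zpow_of_nonzero hq] at h1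
  push_cast at h1
  have hp : (1 : ℝ) < p := by exact_mod_cast (Fact.out : p.Prime).one_lt
  have h2 := (zpow_le_zpow_iff_right₀ hp).mp h1
  omega

/-- **K90-U.** In `ℤ_p`, `p ∤ x` ⟹ `x` is a unit. [folklore] -/
theorem isUnit_of_not_dvd {p : ℕ} [Fact p.Prime] {x : ℤ_[p]} (hx : ¬ (p : ℤ_[p]) ∣ x) : IsUnit x := by
  by_contra hu
  apply hx
  have hm : x ∈ IsLocalRing.maximalIdeal ℤ_[p] := hu
  rw [PadicInt.maximalIdeal_eq_span_p, Ideal.mem_span_singleton] at hm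
  exact hm

/-- `2` is not a unit of `ℤ₂`. [folklore] -/
theorem not_isUnit_two : ¬ IsUnit (2 : ℤ_[2]) := by
  rw [PadicInt.not_isUnit_iff]
  have h : ‖((2 : ℕ) : ℤ_[2])‖ < 1 := by rw [PadicInt.norm_p]; norm_num
  simpa using h

/-! ## K90-Λ — the L-value bit pinch in `Λ = ℤ₂⟦T⟧` -/

/-- The constant term of `(T+2)·H` is `2·H(0)`. [folklore] -/
theorem constantCoeff_X_add_C_two_mul (H : IwasawaAlgebra 2) :
    constantCoeff ((PowerSeries.X + PowerSeries.C (2 : ℤ_[2]) : IwasawaAlgebra 2) * H) = 2 * constantCoeff H := by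
  rw [map_mul, map_add, constantCoeff_X, constantCoeff_C, zero_add]

/-- **K90-Λ — THE L-VALUE BIT PINCH IN `Λ`.**  `(T+2) ∣ G` and `4 ∤ G(0)` ⟹ `μ(G) = 0 ∧ λ(G) = 1`:
`G = (T+2)·H` with `G(0) = 2·H(0)`, so `2 ∤ H(0)`, `H(0) ∈ ℤ₂ˣ`, `H ∈ Λˣ`, and `μ`, `λ` are additive with `μ(T+2) = 0`, `λ(T+2) = 1`,
`μ(H) = λ(H) = 0`. [cite: Washington1997, §7.1] -/
theorem mu_eq_zero_and_lam_eq_one_of_X_add_C_two_dvd_of_not_four_dvd {G : IwasawaAlgebra 2}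
    (hZ : (PowerSeries.X + PowerSeries.C (2 : ℤ_[2]) : IwasawaAlgebra 2) ∣ G) (h4 : ¬ (4 : ℤ_[2]) ∣ constantCoeff G) :
    mu G = 0 ∧ lam G = 1 := by
  obtain ⟨H, rfl⟩ := hZ
  have h2 : ¬ (2 : ℤ_[2]) ∣ constantCoeff H := by
    rintro ⟨c, hc⟩
    exact h4 ⟨c, by rw [constantCoeff_X_add_C_two_mul, hc]; ring⟩
  have hu : IsUnit (constantCoeff H) := isUnit_of_not_dvd (p := 2) (by exact_mod_cast h2)
  have hHu : IsUnit H := isUnit_iff_constantCoeff.mpr hu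
  obtain ⟨hHne, hmuH, hlamH⟩ := (isUnit_iff_mu_eq_zero_and_lam_eq_zero H).mp hHu
  refine ⟨?_, ?_⟩
  · rw [mu_mul FlatBlindPinch.X_add_C_two_ne_zero hHne, hmuH, add_zero]
    exact AlignedTransportAtTwoTwoFixedPoints.mu_X_add_C_two_and_pfree.1
  · rw [lam_mul FlatBlindPinch.X_add_C_two_ne_zero hHne, hlamH, add_zero]
    exact AlignedTransportAtTwoTwoFixedPoints.lam_X_add_C_two

/-- **K90-Λ′ — the converse: the two certificates are EQUIVALENT given the blind zero.**  `G ≠ 0`, `(T+2) ∣ G`, `μ(G) = 0`,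
`λ(G) ≤ 1` ⟹ `4 ∤ G(0)` (`λ(H) = 0 = μ(H)` ⟹ `H ∈ Λˣ` ⟹ `2 ∤ H(0)` ⟹ `4 ∤ 2·H(0)`). [cite: Washington1997, §7.1] -/
theorem not_four_dvd_of_mu_eq_zero_of_lam_le_one {G : IwasawaAlgebra 2} (hG : G ≠ 0)
    (hZ : (PowerSeries.X + PowerSeries.C (2 : ℤ_[2]) : IwasawaAlgebra 2) ∣ G) (hμ : mu G = 0) (hlam : lam G ≤ 1) :
    ¬ (4 : ℤ_[2]) ∣ constantCoeff G := by
  obtain ⟨H, rfl⟩ := hZ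
  have hHne : H ≠ 0 := by rintro rfl; exact hG (mul_zero _)
  have hlamX : lam (PowerSeries.X + PowerSeries.C (2 : ℤ_[2]) : IwasawaAlgebra 2) = 1 := AlignedTransportAtTwoTwoFixedPoints.lam_X_add_C_two
  have hmuX : mu (PowerSeries.X + PowerSeries.C (2 : ℤ_[2]) : IwasawaAlgebra 2) = 0 := AlignedTransportAtTwoTwoFixedPoints.mu_X_add_C_two_and_pfree.1
  have hlamH : lam H = 0 := by
    rw [lam_mul FlatBlindPinch.X_add_C_two_ne_zero hHne, hlamX] at hlam
    omega
  have hmuH : mu H = 0 := by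
    rw [mu_mul FlatBlindPinch.X_add_C_two_ne_zero hHne, hmuX] at hμ
    omega
  have hHu : IsUnit H := (isUnit_iff_mu_eq_zero_and_lam_eq_zero H).mpr ⟨hHne, hmuH, hlamH⟩
  have hu : IsUnit (constantCoeff H) := isUnit_iff_constantCoeff.mp hHu
  rintro ⟨c, hc⟩
  have h2c : constantCoeff H = 2 * c := by
    have h' : (2 : ℤ_[2]) * constantCoeff H = 2 * (2 * c) := by rw [← constantCoeff_X_add_C_two_mul, hc]; ring
    exact mul_left_cancel₀ two_ne_zero h'
  rw [h2c] at hu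
  exact not_isUnit_two (isUnit_of_mul_isUnit_left hu)

/-! ## The avatar's constant term and the two consequences for the line -/

/-- **The constant term of an avatar.**  For the newform `f` of `E = W` (good supersingular at `2`), its period ratio `ϖ`, a Sprung pair
`(L♯, L♭)` at `2` and `G ∈ Λ` with `ι G = C(ϖ)·ι L♭`: `G(0) = c♭·t` in `ℚ₂` with `t = L(E,1)/Ω_E ∈ ℚ` and `c♭ = −a₂² + 2a₂ + 1 ∈ {1, −7}`.
(W-88 ★★ p830132's bookkeeping, isolated.) [cite: Sprung2017, Thm. 1.12, Cor. 4.4] -/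
theorem constantCoeff_avatar (W : WeierstrassCurve ℚ) [W.IsElliptic] [W.IsGloballyMinimal] (hss : GoodSS W 2)
    [NeZero (W.conductorNorm ℤ)] {f : CuspForm (Gamma0 (W.conductorNorm ℤ)) 2} (hf : IsNewformOf W f)
    {ϖ : ℚ} (hϖ : (ϖ : ℝ) * W.realPeriodRat = plusPeriod f)
    {Ls Lf : IwasawaAlgebra 2} (hSP : IsSprungPair f 2 (W.frobeniusTrace 2) Ls Lf)
    {G : IwasawaAlgebra 2} (hG : iwasawaToPowerSeries 2 G = PowerSeries.C (ϖ : ℚ_[2]) * iwasawaToPowerSeries 2 Lf) :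
    ∃ t cf : ℚ, W.entireLFunction 1 / (W.realPeriodRat : ℂ) = ((t : ℚ) : ℂ) ∧
      ((PowerSeries.constantCoeff G : ℤ_[2]) : ℚ_[2]) = (((cf * t : ℚ)) : ℚ_[2]) ∧ (cf = 1 ∨ cf = -7) := by
  have hΩpos : 0 < W.realPeriodRat := W.realPeriodRat_pos_holds
  set s₀ : ℚ := ratPlusSymbol f 0 with hs_def
  set t : ℚ := ϖ * s₀ with ht_def
  have ht : W.entireLFunction 1 / (W.realPeriodRat : ℂ) = ((t : ℚ) : ℂ) := by
    rw [hf.entireLFunction_one_eq, ← hϖ, div_eq_iff (Complex.ofReal_ne_zero.mpr hΩpos.ne'), ht_def]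
    push_cast
    ring
  set cf : ℚ := -(W.frobeniusTrace 2 : ℚ) ^ 2 + 2 * (W.frobeniusTrace 2) + 1 with hcf_def
  have hLf0 := constantCoeff_flat_two_of_isSprungPair_of_isNewformOf hf hss.1 hSP
  have hϖLf : (ϖ : ℚ_[2]) * ((PowerSeries.constantCoeff Lf : ℤ_[2]) : ℚ_[2]) = (((cf * t : ℚ)) : ℚ_[2]) := by
    rw [hLf0, ht_def, hcf_def]
    push_cast
    ring
  have hG0 : ((PowerSeries.constantCoeff G : ℤ_[2]) : ℚ_[2]) = (((cf * t : ℚ)) : ℚ_[2]) := by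
    have hc0 := congrArg PowerSeries.constantCoeff hG
    rw [map_mul PowerSeries.constantCoeff (PowerSeries.C (ϖ : ℚ_[2])), PowerSeries.constantCoeff_C,
      constantCoeff_iwasawaToPowerSeries, constantCoeff_iwasawaToPowerSeries, hϖLf] at hc0
    exact hc0
  have hcf1 : cf = 1 ∨ cf = -7 := by
    rcases frobeniusTrace_two_eq_zero_or W hss.1 hss.2 with h0 | h0 | h0
    · left; rw [hcf_def, h0]; norm_num
    · left; rw [hcf_def, h0]; norm_num
    · right; rw [hcf_def, h0]; norm_num
  exact ⟨t, cf, ht, hG0, hcf1⟩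

/-- `v₂(c♭) = 0` for `c♭ ∈ {1, −7}`. [folklore] -/
theorem padicValRat_cf_eq_zero {cf : ℚ} (hcf : cf = 1 ∨ cf = -7) : padicValRat 2 cf = 0 := by
  rcases hcf with h | h
  · rw [h]; exact padicValRat.one
  · rw [h, show (-7 : ℚ) = -((7 : ℕ) : ℚ) by norm_num, padicValRat.neg, padicValRat.of_nat]
    have h7 : padicValNat 2 7 = 0 := padicValNat.eq_zero_of_not_dvd (by norm_num)
    exact_mod_cast h7

/-- `t = L(E,1)/Ω_E` is determined by `W` (the defining equation pins it). [folklore] -/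
theorem lvalue_ratio_unique (W : WeierstrassCurve ℚ) [W.IsElliptic] {t t' : ℚ}
    (ht : W.entireLFunction 1 / (W.realPeriodRat : ℂ) = ((t : ℚ) : ℂ))
    (ht' : W.entireLFunction 1 / (W.realPeriodRat : ℂ) = ((t' : ℚ) : ℂ)) : t = t' := by
  have h := ht.symm.trans ht'
  exact_mod_cast h

/-- **K90-C — THE BLIND-ZERO CONGRUENCE `2 ∣ L(E,1)/Ω_E`.**  If the characteristic element `ξ` divides an avatar `G` of `ϖ·L♭` (the Kato
half) and carries the blind zero `(T+2) ∣ ξ` (K87-C, from `corank Sel_{2^∞}(E^{(2)}) ≥ 2`), then `2 ∣ G(0) = c♭·L(E,1)/Ω_E` with `c♭`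
odd, i.e. `1 ≤ v₂(L(E,1)/Ω_E)` whenever `L(E,1) ≠ 0`.  A checkable prediction of the line on the named residual R-imc-76.
[cite: GreenbergVatsal2000, p. 4] [cite: Sprung2017, Thm. 1.12, Cor. 4.4] -/
theorem one_le_padicValRat_lvalue_of_blindZero (W : WeierstrassCurve ℚ) [W.IsElliptic] [W.IsGloballyMinimal] (hss : GoodSS W 2)
    [NeZero (W.conductorNorm ℤ)] {f : CuspForm (Gamma0 (W.conductorNorm ℤ)) 2} (hf : IsNewformOf W f)
    {ϖ : ℚ} (hϖ : (ϖ : ℝ) * W.realPeriodRat = plusPeriod f)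
    {Ls Lf : IwasawaAlgebra 2} (hSP : IsSprungPair f 2 (W.frobeniusTrace 2) Ls Lf)
    {ξ G : IwasawaAlgebra 2} (hG : iwasawaToPowerSeries 2 G = PowerSeries.C (ϖ : ℚ_[2]) * iwasawaToPowerSeries 2 Lf)
    (hξG : ξ ∣ G) (hZ : (PowerSeries.X + PowerSeries.C (2 : ℤ_[2]) : IwasawaAlgebra 2) ∣ ξ)
    {t : ℚ} (ht : W.entireLFunction 1 / (W.realPeriodRat : ℂ) = ((t : ℚ) : ℂ)) (ht0 : t ≠ 0) : 1 ≤ padicValRat 2 t := by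
  obtain ⟨t', cf, ht', hG0, hcf⟩ := constantCoeff_avatar W hss hf hϖ hSP hG
  obtain rfl : t' = t := lvalue_ratio_unique W ht' ht
  have hcf0 : cf ≠ 0 := by rcases hcf with h | h <;> rw [h] <;> norm_num
  have h2G : ((2 : ℕ) : ℤ_[2]) ^ 1 ∣ constantCoeff G := by
    obtain ⟨H, hH⟩ := hZ.trans hξG
    refine ⟨constantCoeff H, ?_⟩
    rw [hH, constantCoeff_X_add_C_two_mul]
    push_cast
    ring
  have hv := le_padicValRat_of_pow_dvd (p := 2) (mul_ne_zero hcf0 ht0) hG0 h2G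
  rw [padicValRat.mul hcf0 ht0, padicValRat_cf_eq_zero hcf, zero_add] at hv
  exact_mod_cast hv

/-- **K90-P — THE L-VALUE BIT PINCH.**  `FlatBlindPinch.bsdp_two_of_flatBlindPinch_of_avatar` (W-88 ★★ p830132) with the two table bits
`μ(G) = 0`, `λ(G) ≤ 1` REPLACED by the single, modularity-free L-VALUE BIT `v₂(L(E,1)/Ω_E) ≤ 1` (for the `t ∈ ℚ` with
`L(E,1)/Ω_E = t`; `Ω_E = W.realPeriodRat`, Néron period with components): inside, `(T+2) ∣ ξ ∣ G` and `G(0) = c♭·t` give `4 ∤ G(0)`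
(K90-V), whence `μ(G) = 0 ∧ λ(G) = 1` (K90-Λ), and p830132 concludes `BSDp W 2`. [cite: GreenbergVatsal2000, p. 4]
[cite: Sprung2017, Thm. 1.12, Cor. 4.4] [cite: Kobayashi2003, Thm. 1.2 (shape)] -/
theorem bsdp_two_of_flatBlindPinch_of_lvalue (W : WeierstrassCurve ℚ) [W.IsElliptic] [W.IsGloballyMinimal]
    (hGZK : rank_eq_analyticRank_of_analyticRank_le_one) (hss : GoodSS W 2) (hL1 : W.entireLFunction 1 ≠ 0)
    [NeZero (W.conductorNorm ℤ)] {f : CuspForm (Gamma0 (W.conductorNorm ℤ)) 2} (hf : IsNewformOf W f)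
    {ϖ : ℚ} (hϖ : (ϖ : ℝ) * W.realPeriodRat = plusPeriod f)
    {Ls Lf : IwasawaAlgebra 2} (hSP : IsSprungPair f 2 (W.frobeniusTrace 2) Ls Lf)
    {ξ G : IwasawaAlgebra 2}
    (hG : iwasawaToPowerSeries 2 G = PowerSeries.C (ϖ : ℚ_[2]) * iwasawaToPowerSeries 2 Lf) (hξG : ξ ∣ G)
    (hK : Finite (W.selmerGroupPInfty 2) →
      ∃ u : ℤ_[2]ˣ, ((PowerSeries.constantCoeff ξ : ℤ_[2]) : ℚ_[2]) =
        ((u : ℤ_[2]) : ℚ_[2]) * ((2 : ℕ) : ℚ_[2]) ^ (padicValNat 2 W.tamagawaProduct) *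
          (Nat.card (W.selmerGroupPInfty 2) : ℚ_[2]))
    (hv : ∀ t : ℚ, W.entireLFunction 1 / (W.realPeriodRat : ℂ) = ((t : ℚ) : ℂ) → padicValRat 2 t ≤ 1)
    (hZ : (PowerSeries.X + PowerSeries.C (2 : ℤ_[2]) : IwasawaAlgebra 2) ∣ ξ) : BSDp W 2 := by
  have hΩpos : 0 < W.realPeriodRat := W.realPeriodRat_pos_holds
  obtain ⟨t, cf, ht, hG0, hcf⟩ := constantCoeff_avatar W hss hf hϖ hSP hG
  have ht0 : t ≠ 0 := by
    intro h0
    apply hL1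
    have h1 := ht
    rw [h0, div_eq_iff (Complex.ofReal_ne_zero.mpr hΩpos.ne')] at h1
    simpa using h1
  have hcf0 : cf ≠ 0 := by rcases hcf with h | h <;> rw [h] <;> norm_num
  have h4 : ¬ (4 : ℤ_[2]) ∣ constantCoeff G := by
    intro h4
    have h4' : ((2 : ℕ) : ℤ_[2]) ^ 2 ∣ constantCoeff G := by
      have he : ((2 : ℕ) : ℤ_[2]) ^ 2 = 4 := by push_cast; norm_num
      rw [he]; exact h4
    have hle := le_padicValRat_of_pow_dvd (p := 2) (mul_ne_zero hcf0 ht0) hG0 h4'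
    rw [padicValRat.mul hcf0 ht0, padicValRat_cf_eq_zero hcf, zero_add] at hle
    have hvt := hv t ht
    push_cast at hle
    omega
  obtain ⟨hμ, hlam⟩ := mu_eq_zero_and_lam_eq_one_of_X_add_C_two_dvd_of_not_four_dvd (hZ.trans hξG) h4
  exact FlatBlindPinch.bsdp_two_of_flatBlindPinch_of_avatar W hGZK hss hL1 hf hϖ hSP hG hξG hK hμ hlam.le hZ

end D90

/-- **KERNEL of the L-value-bit pinch branch (v2.18 OPTION W-90; sorry-free).** -/
theorem bsdp_two_of_lvaluePinch (hPub : PublishedInputsAtTwo)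
    (hFD : UniformFlatHondaDataAtTwo) (hMu : FineMuZeroOnHabitatAtTwo)
    (W : WeierstrassCurve ℚ) [W.IsElliptic] [W.IsGloballyMinimal]
    (hCM : ¬ W.HasCM) (hr : W.analyticRank = 0) (hss : GoodSS W 2)
    (hv : ∀ (t : ℚ), W.entireLFunction 1 / (W.realPeriodRat : ℂ) = ((t : ℚ) : ℂ) → padicValRat 2 t ≤ 1)
    (W₂ : WeierstrassCurve ℚ) [W₂.IsElliptic]
    (htw : ∃ C : WeierstrassCurve.VariableChange ℚ, C • W.quadraticTwist 2 = W₂) (h2 : 2 ≤ W₂.selmerCorank 2) :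
    BSDp W 2 := by
  haveI : NeZero (W.conductorNorm ℤ) := ⟨(W.conductorNorm_pos_holds).ne'⟩
  have hL1 : W.entireLFunction 1 ≠ 0 := by
    have hiff := WeierstrassCurve.analyticRank_eq_zero_iff_holds (W := W) (hPub.2.2.1 W)
    exact hiff.mp hr
  -- the cyclotomic `ℤ₂`-extension, a topological generator carrying the cyclotomic variable, and the place over `2`
  obtain ⟨κ, hκ, γ, hγ, hγ'⟩ := exists_isCyclotomic_isTopGenerator_isCyclotomicVariable_holds 2
  set v : HeightOneSpectrum (𝓞 ℚ) := (Rat.HeightOneSpectrum.primesEquiv (R := 𝓞 ℚ)).symm ⟨2, Nat.prime_two⟩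
    with hv_def
  have hv2 : (2 : 𝓞 ℚ) ∈ v.asIdeal := by
    have h := natCast_mem_asIdeal_primesEquiv_symm 2 Nat.prime_two
    simpa [hv_def] using h
  -- stub 2 at this tuple: Sprung's local ♭ data with the Honda₂ clauses, the Honda legality, COUNT♭ and CK♭
  obtain ⟨g, c, hg, hc, hTr, hinj, hsat, hH, hcount, hCK⟩ := hFD W hCM hr hss κ γ hκ hγ hγ' v hv2
  -- modularity (stub 1): the newform `f` of `W`, its rational period ratio `ϖ`; Sprung's pair at `2`; a ♭ dual datum (as `bsdp_two_of_genericOdd`)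
  obtain ⟨Dm⟩ := hPub.1.1 W
  have hf : IsNewformOf W Dm.f := Dm.isNewformOf
  obtain ⟨ϖ, hϖpos, hϖeq, hΩpos⟩ := Dm.exists_rat_mul_realPeriodRat_eq_plusPeriod
  obtain ⟨Ls, Lf, hSP⟩ := exists_isSprungPair_two hf hss.1 hss.2
  obtain ⟨D⟩ := nonempty_sharpFlatSelmerDualData W κ (closureEmb (K := ℚ) (v.adicCompletion ℚ))
    (W.frobeniusTrace 2) g c Chroma.flat hγ
  haveI : Module.Finite (IwasawaAlgebra 2) D.X := D.moduleFinite hγ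
  -- the Kato half at `2` fed by (A) at `(E,2)`: `X♭` torsion, `char X♭ = (ξ)`, `ι(ξ·h) = C(ϖ)·ι L♭`
  obtain ⟨hTors, ξ, h, hchar, hgh⟩ :=
    Summit.BirchSwinnertonDyer.BirchSwinnertonDyer.Theorems.SSFlatRoad.flatUpper_two_of_flatColemanKato_of_fineMu W _
      g c hPub.2.1.1 hPub.2.1.2 hss.1 hss.2 hL1 hκ hγ hγ' (hMu W hCM hr hss) hCK Dm.f hf ϖ hϖeq Ls Lf hSP D
  -- (K) for `ξ`: the tree's EC♭ at `2` fed by COUNT♭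
  have hK : Finite (W.selmerGroupPInfty 2) →
      ∃ u : ℤ_[2]ˣ, ((PowerSeries.constantCoeff ξ : ℤ_[2]) : ℚ_[2]) =
        ((u : ℤ_[2]) : ℚ_[2]) * ((2 : ℕ) : ℚ_[2]) ^ (padicValNat 2 W.tamagawaProduct) *
          (Nat.card (W.selmerGroupPInfty 2) : ℚ_[2]) := fun hfin ↦
    Summit.BirchSwinnertonDyer.BirchSwinnertonDyer.Theorems.SSFlatRoad.flatEulerChar_two W hss κ hγ hv2 hg hc hTr
      hinj hsat hcount D hTors ξ hchar hfin
  -- the blind zero `(T+2) ∣ ξ` from `corank Sel_{2^∞}(E^{(2)}/ℚ) ≥ 2` (K87-C ★★ p827897)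
  have hZ : (PowerSeries.X + PowerSeries.C (2 : ℤ_[2]) : IwasawaAlgebra 2) ∣ ξ :=
    Summit.BirchSwinnertonDyer.BirchSwinnertonDyer.Theorems.BlindPinch.blindZeroOfTwistSelmerCorankAtTwo W hss κ γ hκ hγ hγ'
      v hv2 g c Chroma.flat D hTors ξ hchar W₂ htw h2
  -- the L-value-bit pinch (D-imc-90 K90-P) on the avatar `G := ξ·h`
  exact D90.bsdp_two_of_flatBlindPinch_of_lvalue W hPub.1.2 hss hL1 hf hϖeq hSP hgh (dvd_mul_right ξ h) hK hv hZ

/-- mini-composition: the last two branches (L-value-bit pinch / stub 7 with both escapes) elaborate. -/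
theorem composition_tail_test (hPub : PublishedInputsAtTwo) (hFD : UniformFlatHondaDataAtTwo) (hMu : FineMuZeroOnHabitatAtTwo)
    (hLow : LowerBoundOffGenericOddAtTwo)
    (W : WeierstrassCurve ℚ) [W.IsElliptic] [W.IsGloballyMinimal]
    (hCM : ¬ W.HasCM) (hr : W.analyticRank = 0) (hss : GoodSS W 2)
    (hgen : ¬ (W.rootNumber * ZMod.χ₈ (W.conductorNorm ℤ : ZMod 8) = -1 ∧
      ∃ (W₂ : WeierstrassCurve ℚ) (_ : W₂.IsElliptic) (_ : W₂.IsGloballyMinimal),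
        (∃ C : WeierstrassCurve.VariableChange ℚ, C • W.quadraticTwist 2 = W₂) ∧ W₂.analyticRank = 1))
    (hU : MissingUpperBoundAt W 2) : BSDp W 2 := by
  by_cases hpinch : ∃ (t : ℚ) (W₂ : WeierstrassCurve ℚ) (_ : W₂.IsElliptic),
      W.entireLFunction 1 / (W.realPeriodRat : ℂ) = ((t : ℚ) : ℂ) ∧ padicValRat 2 t ≤ 1 ∧
      (∃ C : WeierstrassCurve.VariableChange ℚ, C • W.quadraticTwist 2 = W₂) ∧ 2 ≤ W₂.selmerCorank 2
  · obtain ⟨t, W₂, _, ht, hvt, htw, h2⟩ := hpinch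
    have hv : ∀ (t' : ℚ), W.entireLFunction 1 / (W.realPeriodRat : ℂ) = ((t' : ℚ) : ℂ) → padicValRat 2 t' ≤ 1 := by
      intro t' ht'
      obtain rfl : t = t' := D90.lvalue_ratio_unique W ht ht'
      exact hvt
    exact bsdp_two_of_lvaluePinch hPub hFD hMu W hCM hr hss hv W₂ htw h2
  · have hL : MissingLowerBoundAt W 2 := by
      refine hLow W hCM hr hss ?_ ?_
      · intro hodd W₂ _ _ htw han
        exact hgen ⟨hodd, W₂, ‹_›, ‹_›, htw, han⟩
      · intro t ht hvt W₂ _ htw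
        by_contra h2
        exact hpinch ⟨t, W₂, ‹_›, ht, hvt, htw, by omega⟩
    exact bsdp_of_missingPPartAt W 2 hPub.1.2 (by omega) (missingPPartAt_of_lower_of_upper W 2 hL hU)

end ScratchV218W90
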